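import Summits.ValiantsHypothesis.ValiantsHypothesis.Theorems.BarrierLeverPartitionMinorsChowSizeFiveBridge

/-!
# Route BarrierLever — Chow witnesses for partition minors (item 20172, CPM): INVERSE CERTIFICATES
# for large minors (list-coded `M · B ≡ 1 (mod p)` checks the kernel runs in `O(r³)`), and the full
# `16 × 16` layout at height `4`

Helper file (`--supports stmt-ValiantsHypothesis-20172`; cell valiant-natproofs, rung V4, 𝒟-side of
door (c); seat val-np-p4 gen 12).  Closes NO item.  The certificates of `…ChowSizeFiveKernel`
(`rep95_certified`) are Laplace determinants (`detL`), whose cost `r!` stops at `r ≈ 6`; the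
door `chow_hit_of_modCert` (`…ChowIntegerCertificates`) takes an inverse matrix over `ZMod p` but as a
`Matrix (Fin r) (Fin r)` literal multiplied by `Matrix.mul`, slow in the kernel.  Here the same
certificate is phrased on LISTS, so that one `decide +kernel` checks an `r × r` inverse certificate in
about `r³` list lookups and integer operations (usable up to `r ≈ 40`, e.g. for `32 × 32` minors at
height `5`):

* `dotZ`, `invCertCheck n p LA LBt` — the Boolean check «rows `LA` times columns `LBt` (the
  TRANSPOSED inverse) is the identity modulo `p`»;
* **`det_ne_zero_of_invCertCheck`** — for ANY integer matrix `A : Matrix (Fin n) (Fin n) ℤ` read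
  through row lists `LA`, a passing check gives `A.det ≠ 0` (generic: not tied to Chow witnesses);
* **`chow_hit_of_invCert`** — the CPM door: if the rows `LA` are the integer partition coefficients
  `chowDP c₀ α β (h+h) (u i) (w j)` of a product of `h + h` integer affine forms and the check passes,
  the layout `(u, w)` is hit;
* demo **`chow_hit_full_height_four`** — the product `T₆` of eight `0/1` affine forms (its certified
  table `t6Final`, `…ChowCertifiedTables`) has NONSINGULAR FULL `16 × 16` partition matrix: the layout
  «all subsets of `Fin 4`» × «all subsets of `Fin 4`» (`r = 16`, far beyond Laplace expansion) is hit
  (`t6_full_invCertCheck`: inverse modulo `101`, one kernel check).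

WHAT THIS IS NOT: certificate plumbing and one height-`4` instance; nothing on items 20172 / 20195 /
19717 themselves, on crux stmt-ValiantsHypothesis-14610, or on `VP` versus `VNP`.
-/

set_option linter.dupNamespace false

namespace Summit.ValiantsHypothesis.ValiantsHypothesis.Theorems.BarrierLever.ChowFactor

open Finset MvPolynomial

/-! ## 1. List-coded inverse certificates -/

/-- Dot product of the first `n` entries of two integer lists (missing entries read as `0`). -/
def dotZ (n : ℕ) (r c : List ℤ) : ℤ := ((List.range n).map fun k => r.getD k 0 * c.getD k 0).sum

/-- `dotZ` as a `Finset.range` sum. -/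
theorem dotZ_eq_sum (n : ℕ) (r c : List ℤ) :
    dotZ n r c = ∑ k ∈ Finset.range n, r.getD k 0 * c.getD k 0 := by
  induction n with
  | zero => simp [dotZ]
  | succ n ih =>
    rw [Finset.sum_range_succ, ← ih]
    simp [dotZ, List.range_succ, List.map_append, List.sum_append]

/-- **The check.**  `LA` = the rows of an `n × n` integer matrix, `LBt` = the COLUMNS of a candidate
inverse modulo `p` (i.e. the transposed inverse, as rows): every entry of `LA · LBtᵀ` is `δ_ij` modulo
`p`. -/
def invCertCheck (n p : ℕ) (LA LBt : List (List ℤ)) : Bool :=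
  (List.range n).all fun i => (List.range n).all fun j =>
    dotZ n (LA.getD i []) (LBt.getD j []) % (p : ℤ) == if i = j then 1 % (p : ℤ) else 0

/-- **Inverse certificate ⇒ nonsingular.**  If an integer matrix `A`, read through the row lists
`LA`, passes `invCertCheck n p LA LBt` for some `p > 1`, then `A.det ≠ 0` (its reduction modulo `p`
has a right inverse). -/
theorem det_ne_zero_of_invCertCheck {n p : ℕ} (hp : 1 < p) (A : Matrix (Fin n) (Fin n) ℤ)
    (LA LBt : List (List ℤ)) (hA : ∀ i j : Fin n, A i j = (LA.getD i []).getD j 0)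
    (h : invCertCheck n p LA LBt = true) : A.det ≠ 0 := by
  classical
  haveI : Fact (1 < p) := ⟨hp⟩
  have hij : ∀ i j : Fin n, ((dotZ n (LA.getD i []) (LBt.getD j [])) : ZMod p) =
      if i = j then 1 else 0 := by
    intro i j
    have h1 := List.all_eq_true.mp (List.all_eq_true.mp h i (List.mem_range.mpr i.2)) j
      (List.mem_range.mpr j.2)
    have h2 : dotZ n (LA.getD i []) (LBt.getD j []) % (p : ℤ) =
        if (i : ℕ) = j then 1 % (p : ℤ) else 0 := by
      simpa only [beq_iff_eq] using h1
    rw [← ZMod.intCast_mod, h2]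
    by_cases e : i = j
    · rw [if_pos (congrArg Fin.val e), if_pos e, ZMod.intCast_mod, Int.cast_one]
    · rw [if_neg (fun e' => e (Fin.ext e')), if_neg e, Int.cast_zero]
  set B : Matrix (Fin n) (Fin n) (ZMod p) := fun k j => (((LBt.getD j []).getD k 0 : ℤ) : ZMod p)
    with hB
  have hmul : (Int.castRingHom (ZMod p)).mapMatrix A * B = 1 := by
    ext i j
    rw [Matrix.mul_apply, Matrix.one_apply, ← hij i j, dotZ_eq_sum,
      ← Fin.sum_univ_eq_sum_range (fun k => (LA.getD i []).getD k 0 * (LBt.getD j []).getD k 0) n]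
    push_cast
    refine Finset.sum_congr rfl fun k _ => ?_
    rw [RingHom.mapMatrix_apply, Matrix.map_apply, hA, hB]
    rfl
  intro hdet
  have h1 : ((Int.castRingHom (ZMod p)).mapMatrix A).det * B.det = 1 := by
    rw [← Matrix.det_mul, hmul, Matrix.det_one]
  rw [← RingHom.map_det, hdet, map_zero, zero_mul] at h1
  exact zero_ne_one h1

/-! ## 2. The CPM door with list certificates -/

/-- **Chow witness from a list-coded inverse certificate.**  If the rows `LA` are the integer
partition coefficients of the product of the `h + h` integer affine forms `(c₀, α, β)` on the layout
`(u, w)` and `invCertCheck r p LA LBt` passes (`p > 1`), the layout is hit (by that very product). -/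
theorem chow_hit_of_invCert {h r : ℕ} (u w : Fin r → Finset (Fin h)) (c₀ : ℕ → ℤ)
    (α β : ℕ → Fin h → ℤ) (p : ℕ) (hp : 1 < p) (LA LBt : List (List ℤ))
    (hLA : ∀ i j : Fin r, (LA.getD i []).getD j 0 = chowDP c₀ α β (h + h) (u i) (w j))
    (hcheck : invCertCheck r p LA LBt = true) :
    ∃ ℓ : Fin (h + h) → MvPolynomial (Fin (h + h)) ℂ, (∀ q, (ℓ q).totalDegree ≤ 1) ∧
      (Matrix.of fun i j : Fin r => coeff
        (∑ b ∈ u i, Finsupp.single (Fin.castAdd h b) 1 + ∑ d ∈ w j, Finsupp.single (Fin.natAdd h d) 1)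
        (∏ q, ℓ q)).det ≠ 0 := by
  classical
  set A : Matrix (Fin r) (Fin r) ℤ := Matrix.of fun i j => chowDP c₀ α β (h + h) (u i) (w j) with hAdef
  have hdetZ : A.det ≠ 0 :=
    det_ne_zero_of_invCertCheck hp A LA LBt (fun i j => by rw [hAdef, Matrix.of_apply, hLA]) hcheck
  refine ⟨fun q => intForm ℂ c₀ α β (q : ℕ), fun q => totalDegree_intForm_le ℂ c₀ α β (q : ℕ), ?_⟩
  have hprod : (∏ q : Fin (h + h), intForm ℂ c₀ α β (q : ℕ)) =
      ∏ k ∈ Finset.range (h + h), intForm ℂ c₀ α β k :=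
    Fin.prod_univ_eq_prod_range (fun k => intForm ℂ c₀ α β k) (h + h)
  have hmat : (Matrix.of fun i j : Fin r => coeff
      (∑ b ∈ u i, Finsupp.single (Fin.castAdd h b) 1 + ∑ d ∈ w j, Finsupp.single (Fin.natAdd h d) 1)
      (∏ q : Fin (h + h), intForm ℂ c₀ α β (q : ℕ))) = (Int.castRingHom ℂ).mapMatrix A := by
    ext i j
    rw [Matrix.of_apply, hprod, coeff_partitionExpo_prod_intForm, RingHom.mapMatrix_apply,
      Matrix.map_apply, hAdef, Matrix.of_apply]
    rfl
  rw [hmat, ← RingHom.map_det]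
  exact (map_ne_zero_iff _ (RingHom.injective_int _)).mpr hdetZ

/-! ## 3. Demo: `T₆` hits the full `16 × 16` layout at height `4` -/

/-- The columns (transposed rows) of the inverse modulo `101` of the full `16 × 16` partition table
`t6Final` of `T₆`. -/
def t6InvT : List (List ℤ) := [
  [44, 58, 52, 14, 72, 18, 28, 16, 73, 73, 77, 10, 93, 27, 66, 41],
  [4, 61, 37, 16, 15, 76, 44, 23, 12, 41, 10, 70, 41, 84, 28, 82],
  [83, 32, 11, 78, 89, 35, 17, 68, 99, 83, 69, 85, 50, 26, 26, 93],
  [49, 42, 7, 84, 81, 44, 73, 25, 84, 89, 97, 31, 14, 37, 29, 21],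
  [32, 23, 11, 36, 8, 93, 75, 5, 36, 29, 99, 69, 77, 45, 5, 31],
  [71, 0, 7, 3, 92, 29, 7, 80, 97, 2, 31, 71, 92, 28, 97, 94],
  [94, 76, 0, 91, 33, 38, 7, 76, 5, 42, 25, 72, 95, 28, 94, 76],
  [4, 57, 43, 98, 8, 74, 31, 79, 86, 25, 97, 96, 80, 47, 17, 22],
  [48, 1, 58, 66, 9, 21, 40, 14, 48, 91, 54, 81, 57, 75, 55, 29],
  [90, 51, 94, 74, 53, 8, 25, 93, 52, 16, 23, 92, 71, 60, 13, 43],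
  [81, 51, 38, 94, 20, 56, 32, 91, 76, 12, 20, 0, 29, 97, 19, 79],
  [7, 66, 74, 0, 83, 82, 80, 91, 85, 75, 60, 72, 47, 87, 61, 77],
  [76, 44, 76, 53, 47, 24, 48, 49, 82, 98, 6, 42, 46, 17, 87, 43],
  [86, 27, 80, 63, 34, 89, 48, 56, 94, 67, 30, 1, 93, 51, 80, 12],
  [10, 80, 90, 0, 64, 7, 72, 72, 98, 82, 46, 94, 65, 68, 31, 12],
  [55, 96, 75, 7, 6, 59, 26, 39, 69, 75, 64, 13, 56, 25, 46, 25]]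

/-- **Kernel check**: `t6Rows · t6InvTᵀ ≡ 1 (mod 101)` — the full table of `T₆` is invertible modulo `101`. -/
theorem t6_full_invCertCheck : invCertCheck 16 101 t6Rows t6InvT = true := by
  decide +kernel

/-- **The full layout at height `4` is hit by `T₆`**: with rows AND columns running over all sixteen
subsets of `Fin 4` (coded by `decode4`), the `16 × 16` partition matrix of the product of the eight
`0/1` affine forms of `T₆` is nonsingular (determinant `-121 483 969 751`, certified through its
inverse modulo `101`). -/
theorem chow_hit_full_height_four :
    ∃ ℓ : Fin (4 + 4) → MvPolynomial (Fin (4 + 4)) ℂ, (∀ q, (ℓ q).totalDegree ≤ 1) ∧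
      (Matrix.of fun i j : Fin 16 => coeff
        (∑ b ∈ decode4 i, Finsupp.single (Fin.castAdd 4 b) 1 +
          ∑ d ∈ decode4 j, Finsupp.single (Fin.natAdd 4 d) 1)
        (∏ q, ℓ q)).det ≠ 0 := by
  refine chow_hit_of_invCert (fun i : Fin 16 => decode4 i) (fun j : Fin 16 => decode4 j) (fun _ => 1)
    (t6Tab t6A) (t6Tab t6B) 101 (by norm_num) t6Rows t6InvT (fun i j => ?_) t6_full_invCertCheck
  have e1 : code4 (decode4 (i : ℕ)) = i := Fin.ext (code4_decode4 i)
  have e2 : code4 (decode4 (j : ℕ)) = j := Fin.ext (code4_decode4 j)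
  rw [chowDP_t6, e1, e2, ← t6R_eq]
  rfl

end Summit.ValiantsHypothesis.ValiantsHypothesis.Theorems.BarrierLever.ChowFactor
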